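import Mathlib.Algebra.MvPolynomial.PDeriv
import Mathlib.RingTheory.MvPolynomial.Homogeneous
import Mathlib.RingTheory.MvPolynomial.Basic
import Mathlib.FieldTheory.Perfect
import Mathlib.Algebra.CharP.Lemmas
import Mathlib.Data.Finsupp.Weight
import Mathlib.Tactic
import HarnessLib

/-!
# K5 — FROBENIUS-LINEARITY OF WILD FORMS: a form all of whose first partials vanish has every exponent divisible by `p`; in degree `p` it is `L^p` with `L` linear

[OURS · L1 W4.5a · res-L1-w45a-lead-1 g14 · kernel brick K5 for crux `FInjectiveMacaulayfication` stmt-ResolutionOfSingularities-15315; companion of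
`Cruxes/FInjectiveMacaulayfication/Lines/T-drop-door.md` (M1) and `Lines/T-cap-regime.md` §1; supports the crux, proves nothing of it; OURS counted 0;
AI-written (AI review is weaker than expert review).]

WHY. In the T-side pricing of T″ below the order cap, a level-2 datum `N` of order `o` is «wild» (no derivative maximal contact) iff all first-order
information of its initial form vanishes, i.e. `∂ in(N)/∂yᵢ = 0` for every `i`; rows #10 (W♯₅), #10♭ (B4) and #11 (drop-point door) of the T-register use the
dichotomy «tame ⟺ some partial of the initial form is non-zero / wild ⟺ the initial form is a `p`-th power». This file puts that dichotomy in the kernel: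
* `cast_mul_coeff_eq_zero_of_pderiv_eq_zero`: over ANY commutative ring, `∂G/∂yᵢ = 0 ⇒ (dᵢ : A)·coeff_d G = 0` for every exponent vector `d` (coefficient formula
  `coeff_m (∂ᵢ G) = coeff_{m+eᵢ} G · (mᵢ + 1)`, Mathlib `MvPolynomial.coeff_pderiv`);
* ★ `dvd_of_pderiv_eq_zero`: over a DOMAIN of characteristic `p`, `∂G/∂yᵢ = 0 ⇒ p ∣ dᵢ` for every monomial `y^d` of `G` — so a form with all partials zero lies in
  `A[y₁^p, …, y_n^p]`, and conversely («tame» = some monomial has an exponent prime to `p` in some letter ⇒ that partial is non-zero: `pderiv_ne_zero_of_not_dvd`);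
* ★★ `exists_linear_pow_eq_of_isHomogeneous` (FROBENIUS-LINEARITY): over a PERFECT FIELD of characteristic `p`, a homogeneous form `G` of degree `p` with all partials
  zero is `L^p` for a LINEAR form `L` (= `Σ cⱼ^{1/p} yⱼ`, since every monomial of `G` is some `yⱼ^p` and Frobenius is additive) — the (M1) lemma of
  `T-drop-door.md`: a wild initial form of degree `p` needs PURE `p`-th powers of the letters.
No named fact; exponent bookkeeping plus Mathlib's `frobeniusEquiv` and `sum_pow_char`.
-/

-- single-problem summit: the doubled namespace component is forced
set_option linter.dupNamespace false

noncomputable section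

open MvPolynomial Finsupp

namespace Summit.ResolutionOfSingularities.ResolutionOfSingularities.Theorems.FInjectiveMacaulayfication.FullWildForm

variable {σ : Type} {A : Type} [CommRing A]

/-- `∂G/∂yᵢ = 0 ⇒ dᵢ · coeff_d(G) = 0` for every exponent vector `d` (any commutative ring). [plumbing; Mathlib `coeff_pderiv`] -/
theorem cast_mul_coeff_eq_zero_of_pderiv_eq_zero {i : σ} {G : MvPolynomial σ A} (h : pderiv i G = 0) (d : σ →₀ ℕ) :
    (d i : A) * coeff d G = 0 := by
  classical
  by_cases hd : d i = 0
  · simp [hd]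
  · have key := coeff_pderiv G (d - single i 1) (i := i)
    rw [h, coeff_zero] at key
    have hsub : d - single i 1 + single i 1 = d := by
      ext j
      rcases eq_or_ne j i with rfl | hj
      · simp only [Finsupp.coe_add, Finsupp.coe_tsub, Pi.add_apply, Pi.sub_apply, single_eq_same]
        omega
      · simp [single_eq_of_ne hj]
    rw [hsub] at key
    have hdi : (((d - single i 1 : σ →₀ ℕ) i + 1 : ℕ) : A) = (d i : A) := by
      congr 1
      simp only [Finsupp.coe_tsub, Pi.sub_apply, single_eq_same]
      omega
    rw [← hdi, mul_comm]
    exact_mod_cast key.symm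

/-- ★ Over a domain of characteristic `p`: if `∂G/∂yᵢ = 0` then `p ∣ dᵢ` for every monomial `y^d` of `G` — a form with all first partials zero lies in
`A[y₁^p, …, y_n^p]`. [OURS; folklore] -/
theorem dvd_of_pderiv_eq_zero [IsDomain A] (p : ℕ) [CharP A p] {i : σ} {G : MvPolynomial σ A} (h : pderiv i G = 0)
    {d : σ →₀ ℕ} (hd : d ∈ G.support) : p ∣ d i := by
  have h1 := cast_mul_coeff_eq_zero_of_pderiv_eq_zero h d
  rcases mul_eq_zero.mp h1 with h2 | h2
  · exact (CharP.cast_eq_zero_iff A p (d i)).mp h2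
  · exact absurd h2 (MvPolynomial.mem_support_iff.mp hd)

/-- «TAME» direction: if some monomial of `G` has an exponent prime to `p` in the letter `yᵢ`, then `∂G/∂yᵢ ≠ 0` (domain of characteristic `p`). [OURS; folklore] -/
theorem pderiv_ne_zero_of_not_dvd [IsDomain A] (p : ℕ) [CharP A p] {i : σ} {G : MvPolynomial σ A} {d : σ →₀ ℕ} (hd : d ∈ G.support)
    (hi : ¬ p ∣ d i) : pderiv i G ≠ 0 :=
  fun h => hi (dvd_of_pderiv_eq_zero p h hd)

/-- An exponent vector of degree `p > 0` all of whose entries are divisible by `p` is `p·eⱼ` for one letter `j`. [plumbing] -/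
theorem eq_single_of_degree_eq_of_forall_dvd (p : ℕ) (hp : 0 < p) (d : σ →₀ ℕ) (hdeg : degree d = p) (hdvd : ∀ i, p ∣ d i) :
    ∃ j, d = single j p := by
  classical
  have hne : d ≠ 0 := by
    intro h0
    rw [h0, map_zero] at hdeg
    omega
  obtain ⟨j, hj⟩ : ∃ j, d j ≠ 0 := by
    by_contra! hall
    exact hne (Finsupp.ext fun i => by simpa using hall i)
  have hjp : d j = p := by
    have h1 : d j ≤ p := hdeg ▸ le_degree j d
    obtain ⟨c, hc⟩ := hdvd j
    rcases Nat.eq_zero_or_pos c with rfl | hcpos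
    · simp at hc; exact absurd hc hj
    · nlinarith
  refine ⟨j, Finsupp.ext fun i => ?_⟩
  rcases eq_or_ne i j with rfl | hij
  · simp [hjp]
  · rw [single_apply, if_neg (Ne.symm hij)]
    by_contra hi
    obtain ⟨c, hc⟩ := hdvd i
    have hcpos : 0 < c := Nat.pos_of_ne_zero (by rintro rfl; simp at hc; exact hi hc)
    have hge : p ≤ d i := by nlinarith
    -- `d i + d j ≤ degree d`
    have hsum : d i + d j ≤ degree d := by
      rw [degree_apply]
      have hsub : ({i, j} : Finset σ) ⊆ d.support := by
        intro s hs
        rcases Finset.mem_insert.mp hs with rfl | hs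
        · exact Finsupp.mem_support_iff.mpr hi
        · rw [Finset.mem_singleton.mp hs]; exact Finsupp.mem_support_iff.mpr hj
      have := Finset.sum_le_sum_of_subset (f := fun s => d s) hsub
      simpa [Finset.sum_pair hij] using this
    omega

/-- ★★ **FROBENIUS-LINEARITY OF WILD FORMS.** Over a perfect field `k` of characteristic `p`, a homogeneous form `G` of degree `p` in `y₁, …, y_n` all of whose first
partials vanish is the `p`-th power of a LINEAR form: `G = L^p`, `L = Σⱼ cⱼ^{1/p}·yⱼ` where `cⱼ = coeff_{p·eⱼ} G`. Hence a «wild» initial form of degree `p` (no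
derivative maximal contact) requires PURE `p`-th powers of the letters — the (M1) lemma behind T-register rows #10/#11. [OURS; folklore] -/
theorem exists_linear_pow_eq_of_isHomogeneous (p : ℕ) [hp : Fact p.Prime] {k : Type} [Field k] [CharP k p] [PerfectRing k p] {n : ℕ}
    (G : MvPolynomial (Fin n) k) (hG : G.IsHomogeneous p) (h : ∀ i, pderiv i G = 0) :
    ∃ L : MvPolynomial (Fin n) k, L.IsHomogeneous 1 ∧ G = L ^ p := by
  classical
  -- every monomial of `G` is a pure `p`-th power of one letter
  have key : ∀ d ∈ G.support, ∃ j, d = single j p := by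
    intro d hd
    refine eq_single_of_degree_eq_of_forall_dvd p hp.out.pos d ?_ fun i => dvd_of_pderiv_eq_zero p (h i) hd
    have := hG (MvPolynomial.mem_support_iff.mp hd)
    rw [← this, degree_eq_weight_one]
    rfl
  let c : Fin n → k := fun j => (frobeniusEquiv k p).symm (coeff (single j p) G)
  refine ⟨∑ j, C (c j) * X j, IsHomogeneous.sum _ _ _ fun j _ => isHomogeneous_C_mul_X _ _, ?_⟩
  have hLp : (∑ j, C (c j) * X j) ^ p = ∑ j : Fin n, C (coeff (single j p) G) * X j ^ p := by
    rw [sum_pow_char]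
    refine Finset.sum_congr rfl fun j _ => ?_
    rw [mul_pow, ← map_pow, frobeniusEquiv_symm_pow_p]
  rw [hLp]
  -- compare coefficients
  ext d
  rw [coeff_sum]
  simp only [coeff_C_mul, X_pow_eq_monomial, coeff_monomial]
  by_cases hd : d ∈ G.support
  · obtain ⟨j, rfl⟩ := key d hd
    rw [Finset.sum_eq_single j]
    · simp
    · intro b _ hb
      rw [if_neg]
      · simp
      · intro hbj
        exact hb (single_left_injective hp.out.ne_zero hbj)
    · simp
  · rw [MvPolynomial.notMem_support_iff.mp hd, eq_comm]
    refine Finset.sum_eq_zero fun j _ => ?_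
    split_ifs with hj
    · rw [hj, MvPolynomial.notMem_support_iff.mp hd, mul_one]
    · rw [mul_zero]

end Summit.ResolutionOfSingularities.ResolutionOfSingularities.Theorems.FInjectiveMacaulayfication.FullWildForm

end
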